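import Summits.AtomisticToContinuum.BoseEinsteinCondensation.Theorems.BECConjugateDominationPositiveMinimiserFreeHeat
import Literature.MathematicalPhysics.QuantumManyBody.GroundStateFeynmanKacInteraction
import Mathlib.Analysis.InnerProductSpace.Calculus
import HarnessLib

/-!
# Route `BECConjugateDomination`, support item `PositiveMinimiser` — the free heat operator, II:
# one derivative from the Gaussian kernel

The smoothing step behind the `C³` regularity of the periodic Feynman–Kac ground state
(item stmt-AtomisticToContinuum-11787): for `t > 0` and a bounded continuous `E`-valued `f`,
`X ↦ P_t f (X) = ∫ gaussKer t (Y - X) • f Y dY` is differentiable, with derivative the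
**Gaussian gradient** `heatGrad t f X = (2t)⁻¹ E[⟨√2 b_t, ·⟩ f(X + √2 b_t)]`
(differentiation of the kernel under the integral, `∇_Z gaussKer t Z = -(2t)⁻¹ Z gaussKer t Z`,
dominated through the Gaussian comparison `gaussianPDFReal_le_sqrt_two_mul` of the tree), and
`‖heatGrad t f X‖ ≤ 3√2 N² ‖f‖_∞ / √t`, `X ↦ heatGrad t f X` continuous. [folklore]
-/

noncomputable section

namespace Summit.AtomisticToContinuum.BoseEinsteinCondensation.Theorems.PositiveMinimiser

open MeasureTheory ProbabilityTheory Filter Set Metric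
open scoped ENNReal NNReal Topology InnerProductSpace
open Literature.MathematicalPhysics.QuantumManyBody.BoseGas
open Literature.Probability.Process (brownian)

variable {N : ℕ} {E : Type} [NormedAddCommGroup E] [NormedSpace ℝ E]

/-! ### The configuration pairing `⟨Z, ·⟩` -/

/-- `‖cfgInner Z‖ ≤ ∑ᵢ ‖Z i‖` (Cauchy–Schwarz per particle and `‖h i‖ ≤ ‖h‖`). [folklore] -/
theorem norm_cfgInner_le (Z : Config N) : ‖cfgInner Z‖ ≤ ∑ i, ‖Z i‖ := by
  refine ContinuousLinearMap.opNorm_le_bound _ (Finset.sum_nonneg fun i _ => norm_nonneg _)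
    fun h => ?_
  rw [cfgInner_apply, Finset.sum_mul]
  refine (norm_sum_le _ _).trans (Finset.sum_le_sum fun i _ => ?_)
  exact (norm_inner_le_norm _ _).trans (mul_le_mul_of_nonneg_left (norm_le_pi_norm h i)
    (norm_nonneg _))

/-- `‖cfgInner Z‖ ≤ N ‖Z‖`. [folklore] -/
theorem norm_cfgInner_le_mul_norm (Z : Config N) : ‖cfgInner Z‖ ≤ N * ‖Z‖ := by
  refine (norm_cfgInner_le Z).trans ?_
  calc ∑ i, ‖Z i‖ ≤ ∑ _i : Fin N, ‖Z‖ := Finset.sum_le_sum fun i _ => norm_le_pi_norm Z i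
    _ = N * ‖Z‖ := by simp

/-- `Z ↦ cfgInner Z` is itself continuous linear, in particular continuous. [folklore] -/
theorem continuous_cfgInner : Continuous (cfgInner (N := N)) := by
  unfold cfgInner
  refine continuous_finsetSum _ fun i _ => ?_
  exact ((ContinuousLinearMap.compL ℝ (Config N) Space ℝ).flip (ContinuousLinearMap.proj i)).continuous.comp
    ((innerSL ℝ).continuous.comp (continuous_apply i))

/-- `(ℓ, e) ↦ ℓ.smulRight e` is continuous (a bounded bilinear map). [folklore] -/
theorem continuous_smulRight_pair :
    Continuous fun p : (Config N →L[ℝ] ℝ) × E => p.1.smulRight p.2 :=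
  isBoundedBilinearMap_smulRight.continuous

/-! ### The squared norm and the closed form of the kernel -/

omit [NormedSpace ℝ E] in
/-- `sqn Z = ∑ᵢ ∑ₖ (Z i k)²`. [folklore] -/
theorem sqn_eq_sum_sum (Z : Config N) : sqn Z = ∑ i, ∑ k, (Z i k) ^ 2 := by
  simp only [sqn, EuclideanSpace.norm_sq_eq, Real.norm_eq_abs, sq_abs]

/-- `D sqn (Z) = 2 cfgInner Z`. [folklore] -/
theorem hasFDerivAt_sqn (Z : Config N) : HasFDerivAt (sqn (N := N)) ((2 : ℝ) • cfgInner Z) Z := by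
  have h : ∀ i ∈ (Finset.univ : Finset (Fin N)), HasFDerivAt (fun Y : Config N => ‖Y i‖ ^ 2)
      (2 • (innerSL ℝ (Z i)).comp (ContinuousLinearMap.proj (R := ℝ) (φ := fun _ : Fin N => Space) i)) Z :=
    fun i _ => (ContinuousLinearMap.proj (R := ℝ) (φ := fun _ : Fin N => Space) i).hasFDerivAt.norm_sq
  have h2 : HasFDerivAt (sqn (N := N))
      (∑ i, 2 • (innerSL ℝ (Z i)).comp (ContinuousLinearMap.proj (R := ℝ) (φ := fun _ : Fin N => Space) i)) Z :=
    HasFDerivAt.fun_sum h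
  refine h2.congr_fderiv ?_
  ext v
  rw [FunLike.coe_smul, Pi.smul_apply, cfgInner_apply, FunLike.coe_sum,
    Finset.sum_apply, Finset.smul_sum]
  refine Finset.sum_congr rfl fun i _ => ?_
  rw [FunLike.coe_smul, Pi.smul_apply, ContinuousLinearMap.comp_apply, innerSL_apply_apply,
    ContinuousLinearMap.proj_apply, smul_eq_mul, two_nsmul, two_mul]

/-- **Closed form of the kernel**: `gaussKer t Z = gaussC N t · exp(-sqn Z / (4t))`. [folklore] -/
theorem gaussKer_eq (t : ℝ≥0) (Z : Config N) :
    gaussKer t Z = gaussC N t * Real.exp (-(sqn Z) / (4 * t)) := by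
  have h1 : ∀ i : Fin N, ∏ k, gaussianPDFReal 0 (2 * t) (Z i k) =
      (∏ _k : Fin 3, (Real.sqrt (2 * Real.pi * (2 * t)))⁻¹) * Real.exp (∑ k, -(Z i k) ^ 2 / (4 * t)) := by
    intro i
    rw [Real.exp_sum, ← Finset.prod_mul_distrib]
    refine Finset.prod_congr rfl fun k _ => ?_
    simp only [gaussianPDFReal, sub_zero, NNReal.coe_mul, NNReal.coe_ofNat]
    congr 2
    ring
  unfold gaussKer gaussC
  simp_rw [h1]
  rw [Finset.prod_mul_distrib, ← Real.exp_sum]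
  congr 2
  rw [sqn_eq_sum_sum, neg_div, Finset.sum_div, ← Finset.sum_neg_distrib]
  refine Finset.sum_congr rfl fun i _ => ?_
  rw [Finset.sum_div, ← Finset.sum_neg_distrib]
  refine Finset.sum_congr rfl fun k _ => ?_
  ring

/-- **Derivative of the kernel**: `D (gaussKer t) (Z) = -((2t)⁻¹ gaussKer t Z) • cfgInner Z`
(`t > 0`). [folklore] -/
theorem hasFDerivAt_gaussKer {t : ℝ≥0} (ht : t ≠ 0) (Z : Config N) :
    HasFDerivAt (gaussKer (N := N) t) (-(((2 * (t : ℝ))⁻¹ * gaussKer t Z) • cfgInner Z)) Z := by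
  have ht' : (0 : ℝ) < t := lt_of_le_of_ne t.coe_nonneg (fun h => ht (by exact_mod_cast h.symm))
  have hfun : gaussKer (N := N) t = fun Y => gaussC N t * Real.exp (-(1 : ℝ) / (4 * t) * sqn Y) := by
    funext Y; rw [gaussKer_eq t Y]; congr 2; ring
  have h1 : HasFDerivAt (fun Y : Config N => -(1 : ℝ) / (4 * t) * sqn Y)
      ((-(1 : ℝ) / (4 * t)) • ((2 : ℝ) • cfgInner Z)) Z := (hasFDerivAt_sqn Z).const_mul _
  have h2 : HasFDerivAt (fun Y : Config N => gaussC N t * Real.exp (-(1 : ℝ) / (4 * t) * sqn Y))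
      (gaussC N t • (Real.exp (-(1 : ℝ) / (4 * t) * sqn Z) • ((-(1 : ℝ) / (4 * t)) • ((2 : ℝ) • cfgInner Z)))) Z :=
    (h1.exp).const_mul (gaussC N t)
  have h3 : HasFDerivAt (gaussKer (N := N) t)
      (gaussC N t • (Real.exp (-(1 : ℝ) / (4 * t) * sqn Z) • ((-(1 : ℝ) / (4 * t)) • ((2 : ℝ) • cfgInner Z)))) Z :=
    h2.congr_of_eventuallyEq (Eventually.of_forall fun Y => by rw [hfun])
  refine h3.congr_fderiv ?_
  have e : gaussKer t Z = gaussC N t * Real.exp (-(1 : ℝ) / (4 * t) * sqn Z) := by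
    rw [gaussKer_eq t Z]; congr 2; ring
  ext v
  simp only [FunLike.coe_smul, Pi.smul_apply, neg_apply, smul_eq_mul, e]
  field_simp
  ring

/-- Norm of the kernel derivative: `‖D gaussKer t (Z)‖ ≤ (2t)⁻¹ gaussKer t Z ∑ᵢ ‖Z i‖`. [folklore] -/
theorem norm_fderiv_gaussKer_le (t : ℝ≥0) (Z : Config N) :
    ‖-(((2 * (t : ℝ))⁻¹ * gaussKer t Z) • cfgInner Z)‖ ≤
      (2 * (t : ℝ))⁻¹ * gaussKer t Z * ∑ i, ‖Z i‖ := by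
  rw [norm_neg, norm_smul, Real.norm_of_nonneg (mul_nonneg (by positivity) (gaussKer_nonneg t Z))]
  exact mul_le_mul_of_nonneg_left (norm_cfgInner_le Z) (mul_nonneg (by positivity) (gaussKer_nonneg t Z))

/-! ### Gaussian comparison under a bounded shift -/

/-- **Shift comparison**: for `‖w‖ ≤ 1`, `gaussKer t (Z - w) ≤ (√2 e^{1/4t})^{3N} gaussKer (2t) Z`.
[folklore] -/
theorem gaussKer_sub_le (t : ℝ≥0) (Z w : Config N) (hw : ‖w‖ ≤ 1) :
    gaussKer t (Z - w) ≤
      (∏ _i : Fin N, ∏ _k : Fin 3, (Real.sqrt 2 * Real.exp (1 ^ 2 / (4 * t)))) * gaussKer (2 * t) Z := by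
  rw [gaussKer, gaussKer, ← Finset.prod_mul_distrib]
  refine Finset.prod_le_prod (fun i _ => Finset.prod_nonneg fun k _ => gaussianPDFReal_nonneg _ _ _)
    fun i _ => ?_
  rw [← Finset.prod_mul_distrib]
  refine Finset.prod_le_prod (fun k _ => gaussianPDFReal_nonneg _ _ _) fun k _ => ?_
  have hwik : |w i k| ≤ 1 := ((abs_coord_le_norm w i k).trans hw)
  have h := gaussianPDFReal_le_sqrt_two_mul (M := 1) 0 t ((Z - w) i k) (-(w i k))
    (by rw [abs_neg]; exact hwik)
  have e : (Z - w) i k - -w i k = Z i k := by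
    simp only [Pi.sub_apply, PiLp.sub_apply, sub_neg_eq_add, sub_add_cancel]
  rwa [e] at h

/-! ### Integrability against the kernel -/

/-- **Transfer of integrability**: `Z ↦ gaussKer t Z • g Z` is Lebesgue integrable iff
`ω ↦ g (√2 b_t(ω))` is integrable (`t > 0`). [folklore] -/
theorem integrable_gaussKer_smul_iff {t : ℝ≥0} (ht : t ≠ 0) {g : Config N → E}
    (hg : AEStronglyMeasurable g volume) :
    Integrable (fun Z => gaussKer t Z • g Z) volume ↔
      Integrable (fun ω => g (displacement t ω)) (wienerPaths N) := by
  have hac : (wienerPaths N).map (displacement t) ≪ volume := by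
    rw [map_displacement_eq_withDensity_gaussKer ht]; exact withDensity_absolutelyContinuous _ _
  have hg' : AEStronglyMeasurable g ((wienerPaths N).map (displacement t)) := hg.mono_ac hac
  have h1 : Integrable (fun ω => g (displacement t ω)) (wienerPaths N) ↔
      Integrable g ((wienerPaths N).map (displacement t)) := by
    rw [integrable_map_measure hg' (measurable_displacement t).aemeasurable]; rfl
  rw [h1, map_displacement_eq_withDensity_gaussKer ht,
    integrable_withDensity_iff_integrable_smul' (measurable_gaussKer t).ennreal_ofReal
      (Eventually.of_forall fun Z => ENNReal.ofReal_lt_top)]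
  refine integrable_congr (Eventually.of_forall fun Z => ?_)
  simp only
  rw [ENNReal.toReal_ofReal (gaussKer_nonneg t Z)]

/-- The kernel times `N + ∑ᵢ ‖Z i‖` is Lebesgue integrable (`t > 0`). [folklore] -/
theorem integrable_gaussKer_mul_poly {t : ℝ≥0} (ht : t ≠ 0) :
    Integrable (fun Z : Config N => gaussKer t Z * ((N : ℝ) + ∑ i, ‖Z i‖)) volume := by
  have hcont : Continuous fun Z : Config N => (N : ℝ) + ∑ i, ‖Z i‖ :=
    continuous_const.add (continuous_finsetSum _ fun i _ => (continuous_apply i).norm)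
  have h := (integrable_gaussKer_smul_iff (E := ℝ) ht hcont.aestronglyMeasurable).2 ?_
  · simpa only [smul_eq_mul] using h
  · refine Integrable.mono' ((integrable_const (N : ℝ)).add
      ((integrable_norm_displacement t).const_mul N))
      (hcont.comp_aestronglyMeasurable (measurable_displacement t).aestronglyMeasurable)
      (Eventually.of_forall fun ω => ?_)
    rw [Real.norm_of_nonneg (add_nonneg (Nat.cast_nonneg _)
      (Finset.sum_nonneg fun i _ => norm_nonneg _))]
    simp only [Pi.add_apply]
    refine add_le_add le_rfl ?_
    calc ∑ i, ‖displacement t ω i‖ ≤ ∑ _i : Fin N, ‖displacement t ω‖ :=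
          Finset.sum_le_sum fun i _ => norm_le_pi_norm _ i
      _ = N * ‖displacement t ω‖ := by simp

/-- The kernel is Lebesgue integrable (`t > 0`). [folklore] -/
theorem integrable_gaussKer {t : ℝ≥0} (ht : t ≠ 0) : Integrable (gaussKer (N := N) t) volume := by
  have h := (integrable_gaussKer_smul_iff (E := ℝ) (N := N) ht
    (g := fun _ => (1 : ℝ)) aestronglyMeasurable_const).2 (integrable_const _)
  simpa using h

/-! ### The Gaussian gradient -/

/-- The integrand of the Gaussian gradient is continuous in the displacement variable.
[folklore] -/
theorem continuous_smulRight_comp {f : Config N → E} (hf : Continuous f) (X : Config N) :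
    Continuous fun Z : Config N => (cfgInner Z).smulRight (f (X + Z)) :=
  continuous_smulRight_pair.comp (continuous_cfgInner.prodMk (hf.comp (continuous_const.add continuous_id)))

/-- Norm of the integrand: `‖(cfgInner Z).smulRight e‖ ≤ N ‖Z‖ ‖e‖`. [folklore] -/
theorem norm_smulRight_cfgInner_le (Z : Config N) (e : E) :
    ‖(cfgInner (N := N) Z).smulRight e‖ ≤ N * ‖Z‖ * ‖e‖ := by
  rw [ContinuousLinearMap.norm_smulRight_apply]
  exact mul_le_mul_of_nonneg_right (norm_cfgInner_le_mul_norm Z) (norm_nonneg _)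

/-- **Bound on the Gaussian gradient**: `‖heatGrad t f X‖ ≤ (2t)⁻¹ · N‖f‖_∞ · E‖√2 b_t‖ ≤
3 √2 N² ‖f‖_∞ / √t`, here in the form `(2t)⁻¹ N M (√2 · 3N · 2√t)`. [folklore] -/
theorem norm_heatGrad_le {f : Config N → E} {M : ℝ} (hM : ∀ Y, ‖f Y‖ ≤ M)
    (t : ℝ≥0) (X : Config N) :
    ‖heatGrad t f X‖ ≤ (2 * (t : ℝ))⁻¹ * (N * M * (Real.sqrt 2 * ((3 * N : ℕ) * (2 * Real.sqrt t)))) := by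
  have hM0 : 0 ≤ M := (norm_nonneg _).trans (hM 0)
  rw [heatGrad, norm_smul, Real.norm_of_nonneg (by positivity)]
  refine mul_le_mul_of_nonneg_left ?_ (by positivity)
  refine (norm_integral_le_integral_norm _).trans ?_
  calc ∫ ω, ‖(cfgInner (displacement t ω)).smulRight (f (X + displacement t ω))‖ ∂wienerPaths N
      ≤ ∫ ω, N * M * ‖displacement t ω‖ ∂wienerPaths N := by
        refine integral_mono_of_nonneg (Eventually.of_forall fun _ => norm_nonneg _)
          ((integrable_norm_displacement t).const_mul _) (Eventually.of_forall fun ω => ?_)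
        calc ‖(cfgInner (displacement t ω)).smulRight (f (X + displacement t ω))‖
            ≤ N * ‖displacement t ω‖ * ‖f (X + displacement t ω)‖ := norm_smulRight_cfgInner_le _ _
          _ ≤ N * ‖displacement t ω‖ * M :=
              mul_le_mul_of_nonneg_left (hM _) (mul_nonneg (Nat.cast_nonneg _) (norm_nonneg _))
          _ = N * M * ‖displacement t ω‖ := by ring
    _ = N * M * ∫ ω, ‖displacement t ω‖ ∂wienerPaths N := integral_const_mul _ _
    _ ≤ N * M * (Real.sqrt 2 * ((3 * N : ℕ) * (2 * Real.sqrt t))) :=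
        mul_le_mul_of_nonneg_left (integral_norm_displacement_le le_rfl) (by positivity)

/-- **The Gaussian gradient is continuous in the base point** (continuous bounded `f`;
dominated convergence). [folklore] -/
theorem continuous_heatGrad {f : Config N → E} (hf : Continuous f) {M : ℝ} (hM : ∀ Y, ‖f Y‖ ≤ M)
    (t : ℝ≥0) : Continuous fun X => heatGrad t f X := by
  have hM0 : 0 ≤ M := (norm_nonneg _).trans (hM 0)
  have hint : Continuous fun X : Config N => ∫ ω : PathSpace N,
      (cfgInner (N := N) (displacement t ω)).smulRight (f (X + displacement t ω)) ∂wienerPaths N := by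
    refine continuous_of_dominated (bound := fun ω => N * M * ‖displacement t ω‖)
      (fun X => (continuous_smulRight_comp hf X).comp_aestronglyMeasurable
        (measurable_displacement t).aestronglyMeasurable)
      (fun X => Eventually.of_forall fun ω => ?_) ((integrable_norm_displacement t).const_mul _)
      (Eventually.of_forall fun ω => ?_)
    · calc ‖(cfgInner (displacement t ω)).smulRight (f (X + displacement t ω))‖
            ≤ N * ‖displacement t ω‖ * ‖f (X + displacement t ω)‖ := norm_smulRight_cfgInner_le _ _
        _ ≤ N * ‖displacement t ω‖ * M :=
            mul_le_mul_of_nonneg_left (hM _) (mul_nonneg (Nat.cast_nonneg _) (norm_nonneg _))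
        _ = N * M * ‖displacement t ω‖ := by ring
    · exact continuous_smulRight_pair.comp (continuous_const.prodMk
        (hf.comp (continuous_id.add continuous_const)))
  unfold heatGrad
  exact hint.const_smul ((2 * (t : ℝ))⁻¹ : ℝ)

/-- **Density form of the Gaussian gradient**:
`heatGrad t f X = ∫ (((2t)⁻¹ gaussKer t Z) • cfgInner Z).smulRight (f (X + Z)) dZ` (`t > 0`).
[folklore] -/
theorem heatGrad_eq_integral {t : ℝ≥0} (ht : t ≠ 0) {f : Config N → E} (hf : Continuous f)
    (X : Config N) :
    heatGrad t f X =
      ∫ Z : Config N, (((2 * (t : ℝ))⁻¹ * gaussKer t Z) • cfgInner (N := N) Z).smulRight (f (X + Z)) := by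
  rw [heatGrad, integral_displacement_eq_integral_gaussKer_smul ht
    (continuous_smulRight_comp hf X).aestronglyMeasurable, ← integral_smul]
  refine integral_congr_ae (Eventually.of_forall fun Z => ?_)
  ext h
  simp only [FunLike.coe_smul, Pi.smul_apply, ContinuousLinearMap.smulRight_apply,
    smul_eq_mul, smul_smul]

/-- **`P_t f` is differentiable with derivative the Gaussian gradient** (`t > 0`, `f` continuous
and bounded): differentiation of the Gaussian kernel under the integral sign, dominated via
the shift comparison `gaussKer_sub_le`. [folklore] -/
theorem hasFDerivAt_heatOp {t : ℝ≥0} (ht : t ≠ 0) {f : Config N → E} (hf : Continuous f) {M : ℝ}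
    (hM : ∀ Y, ‖f Y‖ ≤ M) (X : Config N) :
    HasFDerivAt (heatOp t f) (heatGrad t f X) X := by
  have hM0 : 0 ≤ M := (norm_nonneg _).trans (hM 0)
  have ht' : (0 : ℝ) < t := lt_of_le_of_ne t.coe_nonneg (fun h => ht (by exact_mod_cast h.symm))
  have h2t : (2 : ℝ≥0) * t ≠ 0 := mul_ne_zero two_ne_zero ht
  -- the integrand, its derivative and the dominating function
  set F : Config N → Config N → E := fun X' Y => gaussKer t (Y - X') • f Y with hF
  set F' : Config N → Config N → Config N →L[ℝ] E := fun X' Y =>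
    (((2 * (t : ℝ))⁻¹ * gaussKer t (Y - X')) • cfgInner (Y - X')).smulRight (f Y) with hF'
  set K : ℝ := ∏ _i : Fin N, ∏ _k : Fin 3, (Real.sqrt 2 * Real.exp (1 ^ 2 / (4 * t))) with hK
  have hK0 : 0 ≤ K := Finset.prod_nonneg fun _ _ => Finset.prod_nonneg fun _ _ => by positivity
  set bound : Config N → ℝ := fun Y =>
    (2 * (t : ℝ))⁻¹ * M * K * (gaussKer (2 * t) (Y - X) * ((N : ℝ) + ∑ i, ‖(Y - X) i‖)) with hbound
  have hfun : heatOp t f = fun X' => ∫ Y, F X' Y := by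
    funext X'; exact heatOp_eq_integral_gaussKer_sub_smul ht hf X'
  -- differentiability of the integrand
  have hdiff : ∀ Y X', HasFDerivAt (fun X'' => F X'' Y) (F' X' Y) X' := by
    intro Y X'
    have h1 : HasFDerivAt (fun X'' : Config N => Y - X'') (-(ContinuousLinearMap.id ℝ (Config N))) X' :=
      (hasFDerivAt_id X').const_sub Y
    have h2 : HasFDerivAt (fun X'' : Config N => gaussKer t (Y - X''))
        ((-(((2 * (t : ℝ))⁻¹ * gaussKer t (Y - X')) • cfgInner (Y - X'))).comp
          (-(ContinuousLinearMap.id ℝ (Config N)))) X' :=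
      (hasFDerivAt_gaussKer ht (Y - X')).comp X' h1
    have h3 : HasFDerivAt (fun X'' : Config N => gaussKer t (Y - X'') • f Y)
        (((-(((2 * (t : ℝ))⁻¹ * gaussKer t (Y - X')) • cfgInner (Y - X'))).comp
          (-(ContinuousLinearMap.id ℝ (Config N)))).smulRight (f Y)) X' :=
      h2.smul_const (f Y)
    refine h3.congr_fderiv ?_
    simp only [hF']
    congr 1
    ext h
    simp
  -- measurability
  have hFmeas : ∀ X', AEStronglyMeasurable (F X') volume := fun X' =>
    (((continuous_gaussKer t).comp (continuous_id.sub continuous_const)).smul hf).aestronglyMeasurable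
  have hF'meas : AEStronglyMeasurable (F' X) volume := by
    refine Continuous.aestronglyMeasurable ?_
    refine continuous_smulRight_pair.comp (Continuous.prodMk ?_ hf)
    exact ((continuous_const.mul ((continuous_gaussKer t).comp (continuous_id.sub continuous_const))).smul
      (continuous_cfgInner.comp (continuous_id.sub continuous_const)))
  -- integrability at the base point
  have hFint : Integrable (F X) volume := by
    refine Integrable.mono' (((integrable_gaussKer ht).comp_sub_right X).mul_const M) (hFmeas X)
      (Eventually.of_forall fun Y => ?_)
    simp only [hF, norm_smul, Real.norm_of_nonneg (gaussKer_nonneg _ _)]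
    exact mul_le_mul_of_nonneg_left (hM Y) (gaussKer_nonneg _ _)
  -- the bound
  have hbd : ∀ᵐ Y ∂volume, ∀ X' ∈ ball X 1, ‖F' X' Y‖ ≤ bound Y := by
    refine Eventually.of_forall fun Y X' hX' => ?_
    have hw : ‖X' - X‖ ≤ 1 := (mem_ball_iff_norm.1 hX').le
    have hcmp : gaussKer t (Y - X') ≤ K * gaussKer (2 * t) (Y - X) := by
      have h := gaussKer_sub_le t (Y - X) (X' - X) hw
      rwa [sub_sub_sub_cancel_right] at h
    have hpoly : ∑ i, ‖(Y - X') i‖ ≤ (N : ℝ) + ∑ i, ‖(Y - X) i‖ := by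
      calc ∑ i, ‖(Y - X') i‖ ≤ ∑ i, (‖(Y - X) i‖ + 1) := by
            refine Finset.sum_le_sum fun i _ => ?_
            have e : (Y - X') i = (Y - X) i - (X' - X) i := by
              simp only [Pi.sub_apply]; abel
            rw [e]
            exact (norm_sub_le _ _).trans (add_le_add le_rfl ((norm_le_pi_norm _ i).trans hw))
        _ = (N : ℝ) + ∑ i, ‖(Y - X) i‖ := by
            rw [Finset.sum_add_distrib]; simp [add_comm]
    calc ‖F' X' Y‖ = ‖((2 * (t : ℝ))⁻¹ * gaussKer t (Y - X')) • cfgInner (Y - X')‖ * ‖f Y‖ := by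
          simp only [hF', ContinuousLinearMap.norm_smulRight_apply]
      _ ≤ ((2 * (t : ℝ))⁻¹ * gaussKer t (Y - X') * ∑ i, ‖(Y - X') i‖) * M := by
          refine mul_le_mul ?_ (hM Y) (norm_nonneg _) (mul_nonneg (mul_nonneg (by positivity)
            (gaussKer_nonneg _ _)) (Finset.sum_nonneg fun _ _ => norm_nonneg _))
          have := norm_fderiv_gaussKer_le t (Y - X')
          rwa [norm_neg] at this
      _ ≤ ((2 * (t : ℝ))⁻¹ * (K * gaussKer (2 * t) (Y - X)) * ((N : ℝ) + ∑ i, ‖(Y - X) i‖)) * M := by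
          refine mul_le_mul_of_nonneg_right ?_ hM0
          exact mul_le_mul (mul_le_mul_of_nonneg_left hcmp (by positivity)) hpoly
            (Finset.sum_nonneg fun _ _ => norm_nonneg _)
            (mul_nonneg (by positivity) (mul_nonneg hK0 (gaussKer_nonneg _ _)))
      _ = bound Y := by simp only [hbound]; ring
  have hbint : Integrable bound volume := by
    have h := ((integrable_gaussKer_mul_poly (N := N) h2t).comp_sub_right X).const_mul
      ((2 * (t : ℝ))⁻¹ * M * K)
    exact h
  have hmain := hasFDerivAt_integral_of_dominated_of_fderiv_le (F := F) (F' := F') (x₀ := X)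
    (bound := bound) (ball_mem_nhds X one_pos) (Eventually.of_forall hFmeas) hFint hF'meas hbd
    hbint (Eventually.of_forall fun Y X' _ => hdiff Y X')
  -- identify the derivative with `heatGrad`
  have key : (∫ Y, F' X Y) = heatGrad t f X := by
    rw [heatGrad_eq_integral ht hf X, ← integral_add_left_eq_self (μ := (volume : Measure (Config N))) (F' X) X]
    refine integral_congr_ae (Eventually.of_forall fun Z => ?_)
    simp only [hF', add_sub_cancel_left]
  rw [hfun, ← key]
  exact hmain

end Summit.AtomisticToContinuum.BoseEinsteinCondensation.Theorems.PositiveMinimiser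

end
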